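import Summits.BirchSwinnertonDyer.BirchSwinnertonDyer.Theorems.KolyvaginRoadThreeSchneiderTamAtThreeHeightLogNumeratorExactPCheckerRed
import HarnessLib

/-!
# «The height is the logarithm of the numerator» — part 8b: ingredients of the EXACT SPLIT LAW at `p ≥ 5`

HONEST FRAMING (cell `bsd-stepL`, seat `bsd-stepL-tam3-p2` g5, WIDTH-LEVER second lane «closed-form Schneider
local factor … by Kodaira type (finite case table proved once)»; `--supports stmt-BirchSwinnertonDyer-19154 --as helper`):
THEOREMS ONLY; 0 definitions, 0 named facts, 0 sorry; route-free; Schneider's conjecture and BSD asserted nowhere.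
The split-multiplicative height is `ĥ^{split} = ĥ_{4.1} − log_p(u)²/log_p q_E = ĥ_{4.1} − λ_E·ℓ²`, `λ_E = C⁻²/log_p q_E`
(SW 2013 §4.2, p. 16). To certify it by ONE congruence one needs, besides the exact rational `T` of part 8a for
`ĥ_{4.1}`, rational proxies for `ℓ² = log_E(z)²` (§21), for `C⁻²` at THE Tate parameter (§22) and for `log_p q_E` (§23) —
the last two in the currency of g4's `…Split` (unit part of the Tate parameter `u₁ = U/c₄⁶` from `j`).

* §21 `norm_formalLog_sq_sub_cubicProxy_le_padic` — **`‖ℓ² − (x⁻¹ − (b₂/12)x⁻² + (b₂²/144 + c₄/240)x⁻³)‖ ≤ ‖x‖⁻³`**;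
* §22 `norm_inv_uniformisationScaleSq_add_j_le_padic` — `‖C⁻² + (c₆/c₄)(1 + 744/j)‖ ≤ ‖q‖²` for `tateJ q = j`;
* §23 `norm_padicLog_tateParam_sub_trunc_le_padic` —
  **`‖log_p q − (p−1)⁻¹Σ_{n<N}(−1)ⁿBⁿ⁺¹/(n+1)‖ ≤ max(‖q‖², ‖B₀ − B‖, (N+1)‖B‖^{N+1})`**, `B₀ = u₁^{p−1} − 1 = N_L/c₄^{6(p−1)}`,
  any `B` with `‖B‖ ≤ p⁻¹` (e.g. an integer with `p^c ∣ N_L − B·c₄^{6(p−1)}`).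

References: [SteinWuthrich2013] §4.2; [SilvermanATAEC1994] Thm. V.3.1 (b), Lemma V.5.1; [SilvermanAEC2009] VI.3;
[Iwasawa1972PadicL] §4.4; tree: parts 2b, 5, 6b; g4 `…Split` (`norm_unitPart_tateParam_sub_le`, `ratCast_j_inv_eq_padic`).
-/

noncomputable section

open scoped Classical
open Filter Topology IsUltrametricDist
open WeierstrassCurve Literature.NumberTheory.EllipticCurves
open Literature.NumberTheory.EllipticCurves.SteinWuthrich2013
open Literature.NumberTheory.EllipticCurves.TateCurve
open Literature.NumberTheory.EllipticCurves.Rank1Residual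
open Summit.BirchSwinnertonDyer.Uniform.UI.O2
open Summit.BirchSwinnertonDyer.Rank1Residual Summit.BirchSwinnertonDyer.Rank1Residual.X11b
open Summit.BirchSwinnertonDyer.BirchSwinnertonDyer.Rank1Residual

namespace Summit.BirchSwinnertonDyer.Rank1Residual.X11b.RegMult.HeightLogNumerator

variable {p : ℕ} [hp : Fact p.Prime]

/-! ### §21 `ℓ²` as a cubic in `x⁻¹` -/

section EllSq

variable (V : WeierstrassCurve ℚ_[p]) [V.IsIntegral ℤ_[p]]

set_option maxHeartbeats 400000 in
/-- **`‖ℓ² − (x⁻¹ − (b₂/12)x⁻² + (b₂²/144 + c₄/240)x⁻³)‖_p ≤ ‖x‖_p⁻³`** for a `p`-integral equation over `ℚ_p`, `p ≥ 5`,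
a point with `‖x‖ > 1`, `‖z‖ ≤ p⁻¹` (`ℓ = log_W(−x/y)`): iterate `ℓ² = x⁻¹(1 − (b₂/12)ℓ² + (c₄/240)ℓ⁴ + g)`, `‖g‖ ≤ ‖x‖⁻²`
(part 2b) twice; the errors are `‖x⁻¹g‖ ≤ ‖x‖⁻³` and `p‖x‖⁻⁴ ≤ ‖x‖⁻³`. [cite: SilvermanAEC2009, VI.3] -/
theorem norm_formalLog_sq_sub_cubicProxy_le_padic (hp5 : 5 ≤ p) {x y : ℚ_[p]} (heq : V.toAffine.Equation x y)
    (hx : 1 < ‖x‖) (hz : ‖-x / y‖ ≤ (p : ℝ)⁻¹) :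
    ‖V.padicFormalLog (-x / y) ^ 2 - (x⁻¹ - V.b₂ / 12 * x⁻¹ ^ 2 + (V.b₂ ^ 2 / 144 + V.c₄ / 240) * x⁻¹ ^ 3)‖ ≤
      ‖x‖⁻¹ ^ 3 := by
  set ℓ : ℚ_[p] := V.padicFormalLog (-x / y) with hℓdef
  have hp2 : p ≠ 2 := by omega
  have hp3 : p ≠ 3 := by omega
  have hp1 : (1 : ℝ) ≤ p := by exact_mod_cast hp.out.one_lt.le
  have hp0 : (0 : ℝ) < p := by positivity
  obtain ⟨hsq, hxyn⟩ := V.norm_sq_eq_norm_cube heq hx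
  have hx0 : 0 < ‖x‖ := one_pos.trans hx
  have hX0 : x ≠ 0 := norm_pos_iff.mp hx0
  have hz2 : ‖-x / y‖ ^ 2 = ‖x‖⁻¹ := by rw [norm_div, norm_neg, div_pow, hsq]; field_simp
  set r : ℝ := ‖-x / y‖ with hr
  have hr0 : 0 ≤ r := norm_nonneg _
  have hXi : ‖x⁻¹‖ = r ^ 2 := by rw [norm_inv, ← hz2]
  have hpr : (p : ℝ) * r ≤ 1 := by
    calc (p : ℝ) * r ≤ p * (p : ℝ)⁻¹ := by gcongr
      _ = 1 := mul_inv_cancel₀ hp0.ne'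
  have hr1 : r ≤ 1 := hz.trans (inv_le_one_of_one_le₀ hp1)
  have hpr2 : (p : ℝ) * r ^ 2 ≤ 1 := by
    calc (p : ℝ) * r ^ 2 = ((p : ℝ) * r) * r := by ring
      _ ≤ 1 * 1 := mul_le_mul hpr hr1 hr0 zero_le_one
      _ = 1 := one_mul _
  -- constants
  have hunit : ∀ m : ℕ, Nat.Coprime p m → ‖((m : ℚ_[p]))⁻¹‖ = 1 := fun m hm => by
    rw [norm_inv, Padic.norm_natCast_eq_one_iff.mpr hm, inv_one]
  have hcop2 : Nat.Coprime p 2 := (Nat.coprime_primes hp.out Nat.prime_two).mpr hp2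
  have hcop3 : Nat.Coprime p 3 := (Nat.coprime_primes hp.out Nat.prime_three).mpr hp3
  have h12i : ‖(12 : ℚ_[p])⁻¹‖ = 1 := by
    have h12 : Nat.Coprime p 12 := by
      rw [show (12 : ℕ) = 2 ^ 2 * 3 by norm_num]; exact (Nat.Coprime.pow_right 2 hcop2).mul_right hcop3
    simpa using hunit 12 h12
  have h144i : ‖(144 : ℚ_[p])⁻¹‖ = 1 := by
    have h144 : Nat.Coprime p 144 := by
      rw [show (144 : ℕ) = 2 ^ 4 * 3 ^ 2 by norm_num]
      exact (Nat.Coprime.pow_right 4 hcop2).mul_right (Nat.Coprime.pow_right 2 hcop3)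
    simpa using hunit 144 h144
  have h240 : ‖(240 : ℚ_[p])⁻¹‖ ≤ p := by
    have h := norm_inv_smooth_le_padic hp5 4 1 1; norm_num at h; rw [norm_inv]; exact h
  have hb2 : ‖V.b₂‖ ≤ 1 := by
    have e := congrArg WeierstrassCurve.b₂ V.eq_map_integralModel
    rw [map_b₂] at e; rw [← e]; exact PadicInt.norm_le_one _
  have hc4 : ‖V.c₄‖ ≤ 1 := by
    have e := congrArg WeierstrassCurve.c₄ V.eq_map_integralModel
    rw [map_c₄] at e; rw [← e]; exact PadicInt.norm_le_one _
  have hb12 : ‖V.b₂ / 12‖ ≤ 1 := by rw [div_eq_mul_inv, norm_mul, h12i, mul_one]; exact hb2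
  have hb144 : ‖V.b₂ ^ 2 / 144‖ ≤ 1 := by
    rw [div_eq_mul_inv, norm_mul, h144i, mul_one, norm_pow]; exact pow_le_one₀ (norm_nonneg _) hb2
  have hc240 : ‖V.c₄ / 240‖ ≤ p := by
    rw [div_eq_mul_inv, norm_mul]
    calc ‖V.c₄‖ * ‖(240 : ℚ_[p])⁻¹‖ ≤ 1 * p := by gcongr
      _ = p := one_mul _
  -- inputs
  have hg : ‖x * ℓ ^ 2 - 1 + V.b₂ / 12 * ℓ ^ 2 - V.c₄ / 240 * ℓ ^ 4‖ ≤ r ^ 4 := by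
    have h := norm_x_mul_formalLog_sq_sub_le_padic V hp5 heq hx hz
    rw [← hz2] at h; exact h.trans_eq (by ring)
  have hℓn : ‖ℓ‖ ≤ r := by
    have hℓz : ‖ℓ - -x / y‖ ≤ r ^ 2 := norm_padicFormalLog_sub_self_le_sq_padic V hp5 hz
    rw [show ℓ = (ℓ - -x / y) + -x / y by ring]
    refine (norm_add_le_max _ _).trans (max_le (hℓz.trans ?_) le_rfl)
    calc r ^ 2 = r * r := sq _
      _ ≤ 1 * r := by gcongr
      _ = r := one_mul _
  have hℓ2 : ‖ℓ ^ 2‖ ≤ r ^ 2 := by rw [norm_pow]; exact pow_le_pow_left₀ (norm_nonneg _) hℓn 2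
  have hℓ4 : ‖ℓ ^ 4‖ ≤ r ^ 4 := by rw [norm_pow]; exact pow_le_pow_left₀ (norm_nonneg _) hℓn 4
  set g : ℚ_[p] := x * ℓ ^ 2 - 1 + V.b₂ / 12 * ℓ ^ 2 - V.c₄ / 240 * ℓ ^ 4 with hgdef
  -- first iteration: `‖ℓ² − x⁻¹‖ ≤ r⁴`
  have e1 : ℓ ^ 2 - x⁻¹ = x⁻¹ * g - V.b₂ / 12 * (x⁻¹ * ℓ ^ 2) + V.c₄ / 240 * (x⁻¹ * ℓ ^ 4) := by
    rw [hgdef]; field_simp; ring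
  have hd1 : ‖ℓ ^ 2 - x⁻¹‖ ≤ r ^ 4 := by
    rw [e1]
    refine (norm_add_le_max _ _).trans (max_le ((norm_sub_le_max₃ _ _).trans (max_le ?_ ?_)) ?_)
    · rw [norm_mul, hXi]
      calc r ^ 2 * ‖g‖ ≤ r ^ 2 * r ^ 4 := by gcongr
        _ ≤ 1 * r ^ 4 := by gcongr; exact pow_le_one₀ hr0 hr1
        _ = r ^ 4 := one_mul _
    · rw [norm_mul, norm_mul, hXi]
      calc ‖V.b₂ / 12‖ * (r ^ 2 * ‖ℓ ^ 2‖) ≤ 1 * (r ^ 2 * r ^ 2) := by gcongr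
        _ = r ^ 4 := by ring
    · rw [norm_mul, norm_mul, hXi]
      calc ‖V.c₄ / 240‖ * (r ^ 2 * ‖ℓ ^ 4‖) ≤ p * (r ^ 2 * r ^ 4) := by gcongr
        _ = ((p : ℝ) * r ^ 2) * r ^ 4 := by ring
        _ ≤ 1 * r ^ 4 := by gcongr
        _ = r ^ 4 := one_mul _
  -- second iteration: `‖ℓ² − x⁻¹ + (b₂/12)x⁻²‖ ≤ p·r⁶`
  have e2 : ℓ ^ 2 - (x⁻¹ - V.b₂ / 12 * x⁻¹ ^ 2) =
      x⁻¹ * g - V.b₂ / 12 * (x⁻¹ * (ℓ ^ 2 - x⁻¹)) + V.c₄ / 240 * (x⁻¹ * ℓ ^ 4) := by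
    rw [hgdef]; field_simp; ring
  have hd2 : ‖ℓ ^ 2 - (x⁻¹ - V.b₂ / 12 * x⁻¹ ^ 2)‖ ≤ (p : ℝ) * r ^ 6 := by
    rw [e2]
    have hr6 : r ^ 6 ≤ (p : ℝ) * r ^ 6 := le_mul_of_one_le_left (by positivity) hp1
    refine (norm_add_le_max _ _).trans (max_le ((norm_sub_le_max₃ _ _).trans (max_le ?_ ?_)) ?_)
    · rw [norm_mul, hXi]
      calc r ^ 2 * ‖g‖ ≤ r ^ 2 * r ^ 4 := by gcongr
        _ = r ^ 6 := by ring
        _ ≤ (p : ℝ) * r ^ 6 := hr6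
    · rw [norm_mul, norm_mul, hXi]
      calc ‖V.b₂ / 12‖ * (r ^ 2 * ‖ℓ ^ 2 - x⁻¹‖) ≤ 1 * (r ^ 2 * r ^ 4) := by gcongr
        _ = r ^ 6 := by ring
        _ ≤ (p : ℝ) * r ^ 6 := hr6
    · rw [norm_mul, norm_mul, hXi]
      calc ‖V.c₄ / 240‖ * (r ^ 2 * ‖ℓ ^ 4‖) ≤ p * (r ^ 2 * r ^ 4) := by gcongr
        _ = (p : ℝ) * r ^ 6 := by ring
  -- third iteration
  have e3 : ℓ ^ 2 - (x⁻¹ - V.b₂ / 12 * x⁻¹ ^ 2 + (V.b₂ ^ 2 / 144 + V.c₄ / 240) * x⁻¹ ^ 3) =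
      x⁻¹ * g - V.b₂ / 12 * (x⁻¹ * (ℓ ^ 2 - (x⁻¹ - V.b₂ / 12 * x⁻¹ ^ 2))) +
        V.c₄ / 240 * (x⁻¹ * ((ℓ ^ 2 - x⁻¹) * (ℓ ^ 2 + x⁻¹))) := by
    rw [hgdef]; field_simp; ring
  rw [show ‖x‖⁻¹ ^ 3 = r ^ 6 by rw [← hz2]; ring, e3]
  have hplus : ‖ℓ ^ 2 + x⁻¹‖ ≤ r ^ 2 := (norm_add_le_max _ _).trans (max_le hℓ2 hXi.le)
  refine (norm_add_le_max _ _).trans (max_le ((norm_sub_le_max₃ _ _).trans (max_le ?_ ?_)) ?_)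
  · rw [norm_mul, hXi]
    calc r ^ 2 * ‖g‖ ≤ r ^ 2 * r ^ 4 := by gcongr
      _ = r ^ 6 := by ring
  · rw [norm_mul, norm_mul, hXi]
    calc ‖V.b₂ / 12‖ * (r ^ 2 * ‖ℓ ^ 2 - (x⁻¹ - V.b₂ / 12 * x⁻¹ ^ 2)‖) ≤ 1 * (r ^ 2 * ((p : ℝ) * r ^ 6)) := by
          gcongr
      _ = ((p : ℝ) * r ^ 2) * r ^ 6 := by ring
      _ ≤ 1 * r ^ 6 := by gcongr
      _ = r ^ 6 := one_mul _
  · rw [norm_mul, norm_mul, norm_mul, hXi]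
    calc ‖V.c₄ / 240‖ * (r ^ 2 * (‖ℓ ^ 2 - x⁻¹‖ * ‖ℓ ^ 2 + x⁻¹‖)) ≤ p * (r ^ 2 * (r ^ 4 * r ^ 2)) := by gcongr
      _ = ((p : ℝ) * r ^ 2) * r ^ 6 := by ring
      _ ≤ 1 * r ^ 6 := by gcongr
      _ = r ^ 6 := one_mul _

end EllSq

/-! ### §22 The inverse squared scale at THE Tate parameter, from `j` -/

section ScaleJ

variable {W : WeierstrassCurve ℚ}

/-- **`‖C⁻² + (c₆/c₄)(1 + 744/j)‖_p ≤ ‖q‖_p²` for `tateJ q = j(W)`** (part 5 §13 with `‖q − 1/j‖ ≤ ‖q‖²`): at THE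
Tate parameter the inverse squared uniformisation scale is the RATIONAL `−c₆(c₄³ + 744Δ)/c₄⁴` of the minimal model to
`2ν` digits. [cite: SilvermanATAEC1994, Thm. V.3.1 (b), Lemma V.5.1] [cite: SteinWuthrich2013, §4.2] -/
theorem norm_inv_uniformisationScaleSq_add_j_le_padic [W.IsElliptic] [W.IsGloballyMinimal] (hW : Mult W p)
    {q : ℚ_[p]} (hq : ‖q‖ < 1) (hj : tateJ q = (W.j : ℚ_[p])) :
    ‖(uniformisationScaleSq W p q)⁻¹ + (W.c₆ : ℚ_[p]) / (W.c₄ : ℚ_[p]) * (1 + 744 * ((W.j : ℚ_[p]))⁻¹)‖ ≤ ‖q‖ ^ 2 := by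
  have h1 := norm_inv_uniformisationScaleSq_add_linear_le_padic hW hq
  have h4 : ‖(W.c₄ : ℚ_[p])‖ = 1 := norm_c₄_eq_one_of_hasMultiplicativeReductionAtPrime hW
  have h6 : ‖(W.c₆ : ℚ_[p])‖ = 1 := norm_c₆_eq_one_of_mult hW
  have h744 : ‖(744 : ℚ_[p])‖ ≤ 1 := by exact_mod_cast Padic.norm_int_le_one (p := p) 744
  have hjq : ‖((W.j : ℚ_[p]))⁻¹ - q‖ ≤ ‖q‖ ^ 2 := by rw [← hj, sq]; exact norm_inv_tateJ_sub_le hq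
  have e : (uniformisationScaleSq W p q)⁻¹ + (W.c₆ : ℚ_[p]) / (W.c₄ : ℚ_[p]) * (1 + 744 * ((W.j : ℚ_[p]))⁻¹) =
      ((uniformisationScaleSq W p q)⁻¹ + (W.c₆ : ℚ_[p]) / (W.c₄ : ℚ_[p]) * (1 + 744 * q)) +
        (W.c₆ : ℚ_[p]) / (W.c₄ : ℚ_[p]) * (744 * (((W.j : ℚ_[p]))⁻¹ - q)) := by ring
  rw [e]
  refine (norm_add_le_max _ _).trans (max_le h1 ?_)
  rw [norm_mul, norm_mul, norm_div, h4, h6, div_one, one_mul]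
  calc ‖(744 : ℚ_[p])‖ * ‖((W.j : ℚ_[p]))⁻¹ - q‖ ≤ 1 * ‖q‖ ^ 2 := by gcongr
    _ = ‖q‖ ^ 2 := one_mul _

end ScaleJ

/-! ### §23 `log_p q_E` truncated, from the integer model -/

section TateLogTrunc

variable {W : WeierstrassCurve ℚ}

set_option maxHeartbeats 400000 in
/-- **`log_p q_E` truncated, from the integer model (`p ≥ 5`).** For the integer model `⟨a₁,…,a₆⟩` with `p ∤ c₄`,
`Δ = p^ν·D'` (`p ∤ D'`), `U = D'c₄³ + 744p^νD'²`, `N_L = U^{p−1} − c₄^{6(p−1)}` (g4's `…Split` currency) and ANY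
`B ∈ ℚ_p` with `‖B‖ ≤ p⁻¹`: for THE Tate parameter (`q ≠ 0`, `‖q‖ < 1`, `tateJ q = j`),
**`‖log_p q − (p−1)⁻¹·Σ_{n<N}(−1)ⁿBⁿ⁺¹/(n+1)‖ ≤ max(‖q‖², ‖N_L/c₄^{6(p−1)} − B‖, (N+1)‖B‖^{N+1})`**:
`log_p q = (p−1)⁻¹log_p(u^{p−1})` for the unit part `u`, `‖u − U/c₄⁶‖ ≤ ‖q‖²` (g4), `‖log_p(1+B₁) − log_p(1+B₂)‖ ≤ ‖B₁ − B₂‖`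
(part 6b) and the truncated logarithm (part 5). [cite: SilvermanATAEC1994, Thm. V.3.1 (b), Lemma V.5.1]
[cite: Iwasawa1972PadicL, §4.4] -/
theorem norm_padicLog_tateParam_sub_trunc_le_padic (hp5 : 5 ≤ p) (W : WeierstrassCurve ℚ) {a₁ a₂ a₃ a₄ a₆ : ℤ}
    (hW : W = ⟨a₁, a₂, a₃, a₄, a₆⟩) [W.IsElliptic] {c4 Dp U NL : ℤ} {ν : ℕ}
    (hc4 : c4 = (a₁ ^ 2 + 4 * a₂) ^ 2 - 24 * (2 * a₄ + a₁ * a₃))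
    (hD : (p : ℤ) ^ ν * Dp = -(a₁ ^ 2 + 4 * a₂) ^ 2 * (a₁ ^ 2 * a₆ + 4 * a₂ * a₆ - a₁ * a₃ * a₄ + a₂ * a₃ ^ 2 - a₄ ^ 2) -
      8 * (2 * a₄ + a₁ * a₃) ^ 3 - 27 * (a₃ ^ 2 + 4 * a₆) ^ 2 + 9 * (a₁ ^ 2 + 4 * a₂) * (2 * a₄ + a₁ * a₃) * (a₃ ^ 2 + 4 * a₆))
    (hpc4 : ¬ (p : ℤ) ∣ c4) (hpDp : ¬ (p : ℤ) ∣ Dp)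
    (hU : U = Dp * c4 ^ 3 + 744 * (p : ℤ) ^ ν * Dp ^ 2) (hNL : NL = U ^ (p - 1) - c4 ^ (6 * (p - 1)))
    {B : ℚ_[p]} (hB : ‖B‖ ≤ (p : ℝ)⁻¹) (N : ℕ)
    {q : ℚ_[p]} (hq0 : q ≠ 0) (hq : ‖q‖ < 1) (hj : tateJ q = (W.j : ℚ_[p])) :
    ‖padicLog p q - ((p : ℚ_[p]) - 1)⁻¹ * ∑ n ∈ Finset.range N, (-1) ^ n * B ^ (n + 1) / ((n : ℚ_[p]) + 1)‖ ≤
      max (max (‖q‖ ^ 2) ‖(NL : ℚ_[p]) / (c4 : ℚ_[p]) ^ (6 * (p - 1)) - B‖) ((N + 1) * ‖B‖ ^ (N + 1)) := by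
  have hpP : p.Prime := Fact.out
  have hp2 : p ≠ 2 := by omega
  have hp1 : (1 : ℝ) < p := by exact_mod_cast hpP.one_lt
  have hp1' : (1 : ℝ) ≤ p := hp1.le
  have hp0 : (p : ℚ_[p]) ≠ 0 := by exact_mod_cast hpP.ne_zero
  have hc4n : ‖(c4 : ℚ_[p])‖ = 1 := BinaryQuartic.norm_intCast_eq_one hpc4
  have hDpn : ‖(Dp : ℚ_[p])‖ = 1 := BinaryQuartic.norm_intCast_eq_one hpDp
  have hc40 : (c4 : ℚ_[p]) ≠ 0 := norm_pos_iff.mp (by rw [hc4n]; exact one_pos)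
  have hqp : ‖q‖ ≤ (p : ℝ)⁻¹ := norm_le_inv_of_norm_lt_one hq
  -- `1/j = p^ν Dp / c4³`, `‖q‖ = p^{−ν}`, `ord q = ν`
  have hJ : (tateJ q)⁻¹ = (p : ℚ_[p]) ^ ν * (Dp : ℚ_[p]) / (c4 : ℚ_[p]) ^ 3 := by
    rw [hj, ratCast_j_inv_eq_padic (p := p) W hW hc4 hD]
    push_cast; ring
  have hpn : ‖(p : ℚ_[p]) ^ ν‖ = (p : ℝ) ^ (-(ν : ℤ)) := by
    rw [norm_pow, Padic.norm_p, ← zpow_natCast, inv_zpow']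
  have hqn : ‖q‖ = (p : ℝ) ^ (-(ν : ℤ)) := by
    rw [← inv_inv ‖q‖, ← norm_tateJ_eq hq, ← norm_inv, hJ, norm_div, norm_mul, hpn, norm_pow, hc4n, hDpn,
      one_pow, div_one, mul_one]
  have hval : q.valuation = ν := by
    have h := Padic.norm_eq_zpow_neg_valuation hq0
    rw [hqn] at h
    have := zpow_right_injective₀ (by positivity) hp1.ne' h
    omega
  -- the unit part `u` and its approximation `u₁ = U/c4⁶`
  set u : ℚ_[p] := q * (p : ℚ_[p]) ^ (-q.valuation) with hu
  have hun : ‖u‖ = 1 := norm_mul_zpow_neg_valuation hq0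
  have hu0 : u ≠ 0 := norm_pos_iff.mp (by rw [hun]; exact one_pos)
  set u₁ : ℚ_[p] := (U : ℚ_[p]) / (c4 : ℚ_[p]) ^ 6 with hu₁
  have hu₁eq : ((tateJ q)⁻¹ + 744 * (tateJ q)⁻¹ ^ 2) * (p : ℚ_[p]) ^ (-q.valuation) = u₁ := by
    rw [hval, hJ, hu₁, hU, zpow_neg, zpow_natCast]
    push_cast
    field_simp
  have hu₁n : ‖u₁‖ ≤ 1 := by
    rw [hu₁, norm_div, norm_pow, hc4n, one_pow, div_one]; exact Padic.norm_int_le_one _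
  have happ : ‖u - u₁‖ ≤ ‖q‖ ^ 2 := by
    rw [hu, ← hu₁eq]; exact norm_unitPart_tateParam_sub_le hq0 hq
  -- `log_p q = (p−1)⁻¹ log_p(u^{p−1})`
  have hvalu : u.valuation = 0 := by
    have h := Padic.norm_eq_zpow_neg_valuation hu0
    rw [hun] at h
    have h' : (p : ℝ) ^ (0 : ℤ) = (p : ℝ) ^ (-u.valuation) := by rw [zpow_zero]; exact h
    have := zpow_right_injective₀ (by positivity) hp1.ne' h'
    omega
  set B₀ : ℚ_[p] := u ^ (p - 1) - 1 with hB₀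
  have hB₀lt : ‖B₀‖ < 1 := by rw [hB₀]; exact norm_pow_sub_one_lt_one_of_norm_eq_one hun
  have hB₀p : ‖B₀‖ ≤ (p : ℝ)⁻¹ := norm_le_inv_of_norm_lt_one hB₀lt
  have hlogq : padicLog p q = ((p : ℚ_[p]) - 1)⁻¹ * padicLog p (1 + B₀) := by
    have h1 : (1 : ℚ_[p]) + B₀ = u ^ (p - 1) := by rw [hB₀]; ring
    have hy1 : ‖1 - u ^ (p - 1)‖ < 1 := by
      rw [norm_sub_rev]; exact norm_pow_sub_one_lt_one_of_norm_eq_one hun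
    rw [h1, padicLog_eq_padicLogSeries hy1, padicLog_of_ne_zero hq0]
  -- `‖B₀ − B₁‖ ≤ ‖q‖²` for `B₁ = u₁^{p−1} − 1 = N_L/c₄^{6(p−1)}`
  have hB₁eq : u₁ ^ (p - 1) - 1 = (NL : ℚ_[p]) / (c4 : ℚ_[p]) ^ (6 * (p - 1)) := by
    rw [hNL, hu₁]; push_cast
    rw [div_pow, ← pow_mul, sub_div, div_self (pow_ne_zero _ hc40)]
  have hB01 : ‖B₀ - ((NL : ℚ_[p]) / (c4 : ℚ_[p]) ^ (6 * (p - 1)))‖ ≤ ‖q‖ ^ 2 := by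
    rw [← hB₁eq, hB₀, show u ^ (p - 1) - 1 - (u₁ ^ (p - 1) - 1) = u ^ (p - 1) - u₁ ^ (p - 1) by ring]
    have hpow : ∀ n : ℕ, ‖u ^ n - u₁ ^ n‖ ≤ ‖u - u₁‖ := by
      intro n
      induction n with
      | zero => simp
      | succ n ih =>
        have hid : u ^ (n + 1) - u₁ ^ (n + 1) = u * (u ^ n - u₁ ^ n) + u₁ ^ n * (u - u₁) := by ring
        rw [hid]
        refine (norm_add_le_max _ _).trans (max_le ?_ ?_)
        · rw [norm_mul]
          calc ‖u‖ * ‖u ^ n - u₁ ^ n‖ ≤ 1 * ‖u - u₁‖ := mul_le_mul hun.le ih (norm_nonneg _) zero_le_one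
            _ = ‖u - u₁‖ := one_mul _
        · rw [norm_mul, norm_pow]
          calc ‖u₁‖ ^ n * ‖u - u₁‖ ≤ 1 * ‖u - u₁‖ :=
                mul_le_mul_of_nonneg_right (pow_le_one₀ (norm_nonneg _) hu₁n) (norm_nonneg _)
            _ = ‖u - u₁‖ := one_mul _
    exact (hpow _).trans happ
  have hB0B : ‖B₀ - B‖ ≤ max (‖q‖ ^ 2) ‖(NL : ℚ_[p]) / (c4 : ℚ_[p]) ^ (6 * (p - 1)) - B‖ := by
    rw [show B₀ - B = (B₀ - (NL : ℚ_[p]) / (c4 : ℚ_[p]) ^ (6 * (p - 1))) +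
      ((NL : ℚ_[p]) / (c4 : ℚ_[p]) ^ (6 * (p - 1)) - B) by ring]
    exact (norm_add_le_max _ _).trans (max_le_max hB01 le_rfl)
  -- assemble
  have hc1 : ‖((p : ℚ_[p]) - 1)⁻¹‖ = 1 := by
    rw [norm_inv]
    have : ‖(p : ℚ_[p]) - 1‖ = 1 := by
      rw [show (p : ℚ_[p]) - 1 = ((p - 1 : ℕ) : ℚ_[p]) by rw [Nat.cast_sub hpP.one_le, Nat.cast_one]]
      exact Padic.norm_natCast_eq_one_iff.mpr ((Nat.coprime_self_sub_right hpP.one_le).mpr (Nat.coprime_one_right _))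
    rw [this, inv_one]
  have hdl := norm_padicLog_one_add_sub_padicLog_one_add_le_padic hp2 hB₀p hB
  have htr := norm_padicLog_one_add_sub_sum_le_padic N hB
  rw [hlogq, ← mul_sub, norm_mul, hc1, one_mul,
    show padicLog p (1 + B₀) - ∑ n ∈ Finset.range N, (-1) ^ n * B ^ (n + 1) / ((n : ℚ_[p]) + 1) =
      (padicLog p (1 + B₀) - padicLog p (1 + B)) +
      (padicLog p (1 + B) - ∑ n ∈ Finset.range N, (-1) ^ n * B ^ (n + 1) / ((n : ℚ_[p]) + 1)) by ring]
  exact (norm_add_le_max _ _).trans (max_le_max (hdl.trans hB0B) htr)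

end TateLogTrunc

end Summit.BirchSwinnertonDyer.Rank1Residual.X11b.RegMult.HeightLogNumerator

end
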